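import Literature.Probability.FitznerVanDerHofstad2017.MeanFieldD11Rev10S2aRelaxed
import Literature.Probability.FitznerVanDerHofstad2017.NobleInitialPoint
import HarnessLib

/-!
# HOME DRAFT (pub-lace10 typer g11, 2026-08-23; NOT filed — lead RULING D29 (3); target if filed:
# `Literature/Probability/FitznerVanDerHofstad2017/NobleAssumption43Relaxed.lean`) —
# Assumption 4.3 AT `p` in RELAXED form: its four NON-diagrammatic fields are consequences, not hypotheses (generic `d`)

CITATION HEADER.  This module re-packages [NoBLE17] = R. Fitzner, R. van der Hofstad, *Generalized approach to the non-backtracking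
lace expansion*, PTRF 169 (2017) 1041–1119, Assumption 4.3 (pp. 1086–1088) and App. D Step 1(b) (p. 1110), exactly as the LANDED
`d = 11` module `MeanFieldD11Rev10S2aRelaxed` does for the two App.-D-Step-1 fields (device `BetaMap.Inputs.relaxMu`), and goes two
fields further.  The tree's `NobleAssumption43At d p S i` carries, besides the diagrammatic displays (4.30)–(4.33), (4.35)–(4.48), FOUR
fields that are not diagrammatic estimates:
* `tauHat_nonneg : Ĝ_p(k) ≥ 0` — a THEOREM below `p_c` (Aizenman–Newman 1984 Lemma 3.3; tree `tauHat_nonneg_of_lt_criticalProbI`);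
* `mu_le : μ_p ≤ i.mu`, `mub_le : p ≤ i.mub` — App. D Step 1(b): consequences of `f₁(p) ≤ Γ₁` on the bootstrap window
  (`nobleMu_le_of_nobleF1_le`), resp. of `μ_p ≤ p = p_I` at the initial point (`nobleMu_le_coe`);
* `geom_lt_one : (2d−1)·p/(1−μ_p)·i.xiIotaAbs < 1` — display (4.34), the convergence condition of the geometric `Π^{ι,κ}`-sum; in
  print a CONDITION ON THE CONSTANT `β^{abs}_{Ξ^ι}` given the a-priori bounds on `p` and `μ_p` ([NoBLE17] p. 1087: "(4.34)"; [FvdH17]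
  Assumption 5.7 (5.46), EJP p. 50: "verified explicitly in the Mathematica notebooks"), i.e. ONE numerical inequality once `p ≤ P̄`,
  `μ_p ≤ M̄ < 1` are known: `(2d−1)P̄/(1−M̄)·i.xiIotaAbs < 1`.
§1 `NobleAssumption43RelaxedAt d p S i` := «given `Ĝ_p ≥ 0` and (4.34), Assumption 4.3 at `p` with `i.relaxMu`» — so that a proof of
the relaxed form has to supply ONLY the diagrammatic displays; `NobleAssumption43At.relaxed` (full ⟹ relaxed).  §2 the transports
relaxed ⟹ full: `toAt_of_bounds` (abstract `P̄`, `M̄`), `toAt_of_nobleF1_le` (window, under `f₁(p) ≤ Γ₁` with the Step-1 numbers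
`Γ₁/(2d−1)`, `Γ₁/((2d−1)c_μ)`), `toAt_nbwThresholdI` (initial point `p_I = 1/(2d−1)`, unconditionally in `p`).  Every transport
takes the three CONSTANT-SIDE inequalities (`… ≤ i.mu`, `… ≤ i.mub`, `K̄·i.xiIotaAbs < 1`) as hypotheses —
at a concrete record they are kernel arithmetic (pub-lace10 HOME draft `typed/p13/MeanFieldD10Stage1ST10Relaxed_DRAFT.lean`, d = 10).

HONEST FRAMING.  A re-packaging of hypotheses, generic in `d`; no number of record, no table, no percolation estimate is proved here
beyond the two cited tree theorems it invokes (`Ĝ ≥ 0` below `p_c`; App. D Step 1(b)).  The relaxed form is WEAKER than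
`NobleAssumption43At` as a hypothesis (so a record stated with it is STRONGER); it is NOT Level U: the diagrammatic displays remain.
No sentence about any particular dimension.  pub-lace10 inventory §3 row U-6 («(4.34): 50 l at Level C (kernel), 0 at U»).

[cite: FitznerVanDerHofstad2016NoBLE, Assumption 4.3 (4.30)–(4.49) pp. 1086–1088, esp. (4.34) p. 1086; App. D Step 1(b) p. 1110]
[cite: FitznerVanDerHofstad2017, Assumption 5.7 (5.46) (EJP p. 50); (3.42) (μ_p ≤ p)]
[cite: AizenmanNewman1984, Lemma 3.3]
-/

noncomputable section

namespace Literature.Probability.FitznerVanDerHofstad2017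

open Literature.Barriers.CriticalPhenomena Literature.Probability.Percolation
open Literature.Probability.LatticeModels

variable {d : ℕ}

/-! ## §0 The (4.34) prefactor `(2d−1)·p/(1−μ)` is monotone in `p` and `μ` -/

/-- monotonicity of the (4.34) left-hand side in the a-priori bounds: `0 ≤ p ≤ P̄`, `μ ≤ M̄ < 1`, `0 ≤ X`, `1 ≤ d` give
`(2d−1)p/(1−μ)·X ≤ (2d−1)P̄/(1−M̄)·X`. [cite: FitznerVanDerHofstad2016NoBLE, Assumption 4.3 (4.34) p. 1086] -/
theorem geom434_lhs_mono (hd : 1 ≤ d) {p P μ M X : ℝ} (hp0 : 0 ≤ p) (hpP : p ≤ P) (hμM : μ ≤ M) (hM1 : M < 1)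
    (hX : 0 ≤ X) : (2 * d - 1) * p / (1 - μ) * X ≤ (2 * d - 1) * P / (1 - M) * X := by
  have hd' : (0 : ℝ) ≤ 2 * d - 1 := by
    have : (1 : ℝ) ≤ d := by exact_mod_cast hd
    linarith
  refine mul_le_mul_of_nonneg_right ?_ hX
  exact div_le_div₀ (mul_nonneg hd' (hp0.trans hpP)) (mul_le_mul_of_nonneg_left hpP hd') (by linarith) (by linarith)

/-- (4.34) from a-priori bounds: `p ≤ P̄`, `μ_p ≤ M̄ < 1` and the CONSTANT-SIDE inequality `(2d−1)P̄/(1−M̄)·β^{abs}_{Ξ^ι} < 1` give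
`(2d−1)p/(1−μ_p)·β^{abs}_{Ξ^ι} < 1` (no sign hypothesis on the constant: for `β < 0` the left side is `≤ 0`).
[cite: FitznerVanDerHofstad2016NoBLE, Assumption 4.3 (4.34) p. 1086] -/
theorem geom434_of_bounds (hd : 1 ≤ d) (p : unitInterval) {P M X : ℝ} (hpP : (p : ℝ) ≤ P) (hμM : nobleMu d p ≤ M)
    (hM1 : M < 1) (hK : (2 * d - 1) * P / (1 - M) * X < 1) :
    (2 * d - 1) * (p : ℝ) / (1 - nobleMu d p) * X < 1 := by
  rcases le_or_gt 0 X with hX | hX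
  · exact (geom434_lhs_mono hd p.2.1 hpP hμM hM1 hX).trans_lt hK
  · have hd' : (0 : ℝ) ≤ 2 * d - 1 := by
      have : (1 : ℝ) ≤ d := by exact_mod_cast hd
      linarith
    have h0 : 0 ≤ (2 * d - 1) * (p : ℝ) / (1 - nobleMu d p) :=
      div_nonneg (mul_nonneg hd' p.2.1) (by linarith)
    exact (mul_nonpos_of_nonneg_of_nonpos h0 hX.le).trans_lt one_pos

/-! ## §1 The relaxed form of Assumption 4.3 at `p` -/

/-- **Assumption 4.3 at `p`, RELAXED**: GIVEN `Ĝ_p(k) ≥ 0` on the cube and GIVEN display (4.34), Assumption 4.3 holds at `p` for the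
split `S` with the constants `i.relaxMu` (the two App.-D-Step-1 fields trivialised).  A proof of this Prop supplies exactly the
diagrammatic displays (4.30)–(4.33), (4.35)–(4.48) with the constants `i` (the fields `tauHat_nonneg` / `geom_lt_one` are the two
antecedents by name, `mu_le` / `mub_le` are `μ_p ≤ 1` / `p ≤ 1`). [cite: FitznerVanDerHofstad2016NoBLE, Assumption 4.3 (4.30)–(4.49) pp. 1086–1088; App. D Step 1(b) p. 1110] -/
def NobleAssumption43RelaxedAt (d : ℕ) (p : unitInterval) (S : NobleSplit d p) (i : BetaMap.Inputs) : Prop :=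
  (∀ k ∈ cube d, 0 ≤ tauHat d p k) →
    (2 * d - 1) * (p : ℝ) / (1 - nobleMu d p) * i.xiIotaAbs < 1 → NobleAssumption43At d p S i.relaxMu

/-- full ⟹ relaxed (the relaxed form is the WEAKER hypothesis). [cite: FitznerVanDerHofstad2016NoBLE, Assumption 4.3 pp. 1086–1088] -/
theorem NobleAssumption43At.relaxed {p : unitInterval} {S : NobleSplit d p} {i : BetaMap.Inputs}
    (h : NobleAssumption43At d p S i) : NobleAssumption43RelaxedAt d p S i := fun _ _ => h.to_relaxMu

/-- how a diagrammatic proof DISCHARGES the relaxed form: the sixty-less-four displays packaged as «Assumption 4.3 with `i.relaxMu`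
from the two antecedents» is literally the definition. [cite: FitznerVanDerHofstad2016NoBLE, Assumption 4.3 pp. 1086–1088] -/
theorem NobleAssumption43RelaxedAt.of_imp {p : unitInterval} {S : NobleSplit d p} {i : BetaMap.Inputs}
    (h : (∀ k ∈ cube d, 0 ≤ tauHat d p k) →
      (2 * d - 1) * (p : ℝ) / (1 - nobleMu d p) * i.xiIotaAbs < 1 → NobleAssumption43At d p S i.relaxMu) :
    NobleAssumption43RelaxedAt d p S i := h

/-! ## §2 Transports relaxed ⟹ full -/

/-- **relaxed ⟹ full from a-priori bounds** (`2 ≤ d`, `p < p_c`): `p ≤ P̄`, `μ_p ≤ M̄ < 1`, the record's Step-1 fields bound `μ_p` and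
`p`, and the constant-side (4.34) `(2d−1)P̄/(1−M̄)·i.xiIotaAbs < 1`; `Ĝ_p ≥ 0` is Aizenman–Newman.
[cite: FitznerVanDerHofstad2016NoBLE, Assumption 4.3 (4.34) p. 1086; App. D Step 1(b) p. 1110] [cite: AizenmanNewman1984, Lemma 3.3] -/
theorem NobleAssumption43RelaxedAt.toAt_of_bounds (hd : 2 ≤ d) {p : unitInterval} (hp : p < criticalProbI d)
    {S : NobleSplit d p} {i : BetaMap.Inputs} {P M : ℝ} (hpP : (p : ℝ) ≤ P) (hμM : nobleMu d p ≤ M) (hM1 : M < 1)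
    (hmu : nobleMu d p ≤ i.mu) (hmub : (p : ℝ) ≤ i.mub)
    (hK : (2 * d - 1) * P / (1 - M) * i.xiIotaAbs < 1) (h : NobleAssumption43RelaxedAt d p S i) :
    NobleAssumption43At d p S i :=
  (h (tauHat_nonneg_of_lt_criticalProbI hd hp) (geom434_of_bounds (by omega) p hpP hμM hM1 hK)).of_relaxMu hmu hmub

/-- **relaxed ⟹ full ON THE BOOTSTRAP WINDOW** (`2 ≤ d`, `p < p_c`, `0 < c_μ`, `Γ₁ < (2d−1)c_μ`): under `f₁(p) ≤ Γ₁` App. D Step 1(b)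
gives `p ≤ Γ₁/(2d−1)`, `μ_p ≤ Γ₁/((2d−1)c_μ)`; it remains that the record's Step-1 fields are at least these numbers and the
constant-side (4.34) `Γ₁/(1 − Γ₁/((2d−1)c_μ))·i.xiIotaAbs < 1`.
[cite: FitznerVanDerHofstad2016NoBLE, App. D Step 1(b) p. 1110; Assumption 4.3 (4.34) p. 1086] [cite: AizenmanNewman1984, Lemma 3.3] -/
theorem NobleAssumption43RelaxedAt.toAt_of_nobleF1_le (hd : 2 ≤ d) {p : unitInterval} (hp : p < criticalProbI d)
    {S : NobleSplit d p} {i : BetaMap.Inputs} {cμ Γ₁ : ℝ} (hcμ : 0 < cμ) (hΓ : Γ₁ < (2 * d - 1) * cμ)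
    (hf : nobleF1 d cμ p ≤ Γ₁) (hmu : Γ₁ / ((2 * d - 1) * cμ) ≤ i.mu) (hmub : Γ₁ / (2 * d - 1) ≤ i.mub)
    (hK : Γ₁ / (1 - Γ₁ / ((2 * d - 1) * cμ)) * i.xiIotaAbs < 1)
    (h : NobleAssumption43RelaxedAt d p S i) : NobleAssumption43At d p S i := by
  have hd1 : 1 ≤ d := by omega
  have hd' : (0 : ℝ) < 2 * d - 1 := by
    have : (2 : ℝ) ≤ d := by exact_mod_cast hd
    linarith
  obtain ⟨hpP, hμM⟩ := nobleMu_le_of_nobleF1_le hd1 hcμ hf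
  have hM1 : Γ₁ / ((2 * d - 1) * cμ) < 1 := (div_lt_one (mul_pos hd' hcμ)).2 hΓ
  refine h.toAt_of_bounds hd hp hpP hμM hM1 (hμM.trans hmu) (hpP.trans hmub) ?_
  rwa [mul_div_cancel₀ _ hd'.ne']

/-- **relaxed ⟹ full AT THE INITIAL POINT `p_I = 1/(2d−1)`** (`2 ≤ d`; `p_I < p_c` is `nbwThresholdI_lt_criticalProbI`): `μ_{p_I} ≤ p_I`
((3.42)); it remains that the record's Step-1 fields are at least `1/(2d−1)` and the constant-side (4.34)
`(1/(1 − 1/(2d−1)))·i.xiIotaAbs < 1`. [cite: FitznerVanDerHofstad2016NoBLE, Assumption 4.3 (z = z_I) p. 1086, (4.34) p. 1086]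
[cite: FitznerVanDerHofstad2017, (3.42) (μ_p ≤ p)] [cite: AizenmanNewman1984, Lemma 3.3] -/
theorem NobleAssumption43RelaxedAt.toAt_nbwThresholdI (hd : 2 ≤ d) {S : NobleSplit d (nbwThresholdI d)} {i : BetaMap.Inputs}
    (hmu : 1 / (2 * d - 1) ≤ i.mu) (hmub : 1 / (2 * d - 1) ≤ i.mub)
    (hK : 1 / (1 - 1 / (2 * d - 1)) * i.xiIotaAbs < 1) (h : NobleAssumption43RelaxedAt d (nbwThresholdI d) S i) :
    NobleAssumption43At d (nbwThresholdI d) S i := by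
  have hd1 : 1 ≤ d := by omega
  have hd' : (1 : ℝ) < 2 * d - 1 := by
    have : (2 : ℝ) ≤ d := by exact_mod_cast hd
    linarith
  have hpI : ((nbwThresholdI d : unitInterval) : ℝ) = 1 / (2 * d - 1) := by rw [coe_nbwThresholdI hd1, nbwThreshold]
  have hpP : ((nbwThresholdI d : unitInterval) : ℝ) ≤ 1 / (2 * d - 1) := hpI.le
  have hμM : nobleMu d (nbwThresholdI d) ≤ 1 / (2 * d - 1) := (nobleMu_le_coe _).trans hpP
  have hM1 : (1 : ℝ) / (2 * d - 1) < 1 := (div_lt_one (by linarith)).2 hd'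
  refine h.toAt_of_bounds hd (nbwThresholdI_lt_criticalProbI hd) hpP hμM hM1 (hμM.trans hmu) (hpP.trans hmub) ?_
  rwa [mul_one_div_cancel (by linarith : (2 : ℝ) * d - 1 ≠ 0)]

end Literature.Probability.FitznerVanDerHofstad2017

end
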